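import Summits.QuantumFields.YangMills.Theorems.BalabanUVNodesN20HybridClassLawCharacterisation

/-!
# BalabanUVNodes ∕ node N20 (NE7b) — THE CLASS-LAW TV LETTER CONTRACTS UNDER KEY COARSENING, BY NAME: pushing the two runs' class weights forward along any
# fibre map `f : ι → κ` (a coarser key) preserves totals and can only SHRINK the per-set total-variation letter of p609004, so `Target ∧ TV-letter at the fine key
# ⇒ ∃ shA shB, HybridNE7` at every coarser key

Cell `pub-ymgap` (HUMAN RULING D-0062 Track A ∕ director-ym R399 (3a) second-wave width seats), WIDTH SEAT `pub-ymgap-dag-n20-w4` (node n20 = NE7b),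
generation g2, CLAIM-2 ∕ INTENT-2 (bus 2026-08-28T07:31:55Z; trigger (t1) = referee ref-Q READ-16 NIT (N2) on this lineage's p609004: «READING (iii) "TV contracts
under coarsening" prose-only (true; a by-name consumer needs the 5-line lemma)»).  Key item K3⁷ `SpineGivenEndpointR13SepCoPH` (stmt-QuantumFields-20544; skeleton of
record v5 941dddb108cbaacf, stub 2 `stub_expansion13H`); filed `--kind proof --supports … --as helper`.  COUNT-NEUTRAL.  THEOREMS ONLY (0 `def`, 0 `instance`,
0 `sorry`).  ADDITIVE — imports this lineage's `…N20HybridClassLawCharacterisation` (p609004) only; modifies nothing.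

CONTENT [folklore — data processing for the per-set total-variation letter; the Sketch's `l1_push_le` ∕ `bc_le_bc_push` are the ℓ¹ ∕ affinity forms in the
Cruxes drawer, not importable here].  The pushed-forward («fibre-summed») weights along `f` are SPELLED OUT as `k ↦ Σ_{τ ∈ T, f τ = k} A τ` on the coarse class
set `T.image f` (no `def`):
* §1 one class set: `sum_push_eq_sum_filter` (`Σ_{k ∈ S′} Σ_{τ ∈ T, f τ = k} A τ = Σ_{τ ∈ T, f τ ∈ S′} A τ`), `sum_push_image_eq_sum` (totals are preserved),
  ★ `abs_pushClassLaw_sub_le_of_classLaw` (the per-set letter `∀ S ⊆ T, |Σ_S A∕Σ_T A − Σ_S B∕Σ_T B| ≤ ρ` at the fine key ⇒ the same letter, same `ρ`, for the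
  pushed weights on every `S′ ⊆ T.image f` — each coarse set pulls back to ONE fine set).
* §2 along `K` (carriers `T : ℕ → Finset ι`, one coarsening map per level `f : ℕ → ι → κ`, weights `A B : ℕ → ℝ → ι → ℝ`): ★ `classLawTV_push_of_classLawTV`
  (p609004's hypothesis `hρ` at the fine key ⇒ `hρ` VERBATIM for `T′ K := (T K).image (f K)`, `A′ K t k := Σ_{τ ∈ T K, f K τ = k} A K t τ`, `B′` likewise, same `ρ`);
  ★★ `exists_hybridNE7_push_of_target_of_classLawTV` (nonnegative terms, positive totals, the E1∕E2 dictionary, `Target vol l₀ δ Z`, TV radius `0 ≤ ρ_K < 1`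
  summable, `hρ` — all AT THE FINE KEY ⇒ `∃ shA shB, HybridNE7 l₀ vol T′ A′ B′ (fun _ _ => ∅) (fun _ => 0) shA shB ρ δ` AT THE COARSE KEY, by p609004
  `exists_hybridNE7_of_target_of_classLawTV` BY NAME on the pushed data — totals, dictionary and Target are unchanged, the letter contracts).
READING (located).  This is p609004's READING (iii) as a theorem: descending from a key to any coarser key (idea-3's `kr := wkey` re-keying, dag-n19-w1's «free
descent») costs NOTHING on the class-law road; the converse (ascent) is not claimed (dag-n19-w1 `…N19RekeyingAbsorption` ∕ `…RekeyingAscent` price it).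

HONEST FRAMING.  [folklore] finite-sum bookkeeping (`Finset.sum_fiberwise_of_maps_to`) on the tree's SHAPES; NO estimate of the programme; nothing of Bałaban's
asserted or instantiated; NE7 ∕ NE7b ∕ NE7c NOT PRINTED as two-run statements for d = 4 and NOT proved; N19 ∕ N20 ∕ N21 NOT discharged; K3⁷ OPEN, v5 STANDS, not
claimed; no summit statement is proved by this seat; counts UNMOVED (typed 28∕28 · discharged 5∕28).  One finite four-torus programme at fixed ε — NOT ℝ⁴, NOT
infinite volume, NOT OS, NOT a mass gap, NOT the Clay problem (R4 closes the conditional finite-𝕋⁴ rung `BalabanLadder.UV` only).  0 `def`; 0 `sorry`; standard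
axioms; no cite tags.
-/

noncomputable section

namespace Summit.QuantumFields.YangMills.BalabanUVNodes.N20ClassLawTVCoarsening

open Finset
open Summit.QuantumFields.BalabanUV.T4Continuum.Spine.NE7 (Target)
open Literature.MathematicalPhysics.QuantumFieldTheory.Balaban1983to89
open T4MatchingAssembly (HybridNE7)
open Summit.QuantumFields.YangMills.BalabanUVNodes.N20HybridClassLawCharacterisation (exists_hybridNE7_of_target_of_classLawTV)

variable {ι κ : Type*} [DecidableEq κ]

/-! ## §1 One class set: pushing forward along a fibre map preserves totals and every coarse set pulls back to a fine set [folklore] -/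
section One

/-- [folklore] the pushed-forward weight summed over a coarse set `S′` is the fine weight of its preimage:
`Σ_{k ∈ S′} Σ_{τ ∈ T, f τ = k} A τ = Σ_{τ ∈ T, f τ ∈ S′} A τ`. -/
theorem sum_push_eq_sum_filter (T : Finset ι) (f : ι → κ) (A : ι → ℝ) (S' : Finset κ) :
    ∑ k ∈ S', ∑ τ ∈ T.filter (fun τ => f τ = k), A τ = ∑ τ ∈ T.filter (fun τ => f τ ∈ S'), A τ := by
  rw [← sum_fiberwise_of_maps_to (s := T.filter (fun τ => f τ ∈ S')) (t := S') (g := f) (f := A)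
    (fun τ hτ => (mem_filter.1 hτ).2)]
  refine sum_congr rfl fun k hk => sum_congr ?_ fun _ _ => rfl
  ext τ
  simp only [mem_filter]
  constructor
  · rintro ⟨hτ, rfl⟩; exact ⟨⟨hτ, hk⟩, rfl⟩
  · rintro ⟨⟨hτ, _⟩, h⟩; exact ⟨hτ, h⟩

/-- [folklore] pushing forward preserves the total: `Σ_{k ∈ T.image f} Σ_{τ ∈ T, f τ = k} A τ = Σ_T A`. -/
theorem sum_push_image_eq_sum (T : Finset ι) (f : ι → κ) (A : ι → ℝ) :
    ∑ k ∈ T.image f, ∑ τ ∈ T.filter (fun τ => f τ = k), A τ = ∑ τ ∈ T, A τ := by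
  rw [sum_push_eq_sum_filter]
  refine sum_congr ?_ fun _ _ => rfl
  ext τ
  simp only [mem_filter, and_iff_left_iff_imp]
  exact fun hτ => mem_image_of_mem f hτ

/-- **★ THE PER-SET CLASS-LAW LETTER CONTRACTS UNDER COARSENING** [folklore; data processing].  If the two runs' normalised class laws at the fine key are
`ρ`-close on every set of classes, `∀ S ⊆ T, |Σ_S A∕Σ_T A − Σ_S B∕Σ_T B| ≤ ρ`, then so are their push-forwards along any `f : ι → κ` on every coarse set
`S′ ⊆ T.image f` — the coarse difference on `S′` IS the fine difference on the preimage `{τ ∈ T : f τ ∈ S′}`. -/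
theorem abs_pushClassLaw_sub_le_of_classLaw {T : Finset ι} {f : ι → κ} {A B : ι → ℝ} {ρ : ℝ}
    (hρ : ∀ S ⊆ T, |(∑ τ ∈ S, A τ) / (∑ τ ∈ T, A τ) - (∑ τ ∈ S, B τ) / (∑ τ ∈ T, B τ)| ≤ ρ)
    {S' : Finset κ} (_hS' : S' ⊆ T.image f) :
    |(∑ k ∈ S', ∑ τ ∈ T.filter (fun τ => f τ = k), A τ) / (∑ k ∈ T.image f, ∑ τ ∈ T.filter (fun τ => f τ = k), A τ)
        - (∑ k ∈ S', ∑ τ ∈ T.filter (fun τ => f τ = k), B τ) / (∑ k ∈ T.image f, ∑ τ ∈ T.filter (fun τ => f τ = k), B τ)| ≤ ρ := by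
  rw [sum_push_image_eq_sum, sum_push_image_eq_sum, sum_push_eq_sum_filter, sum_push_eq_sum_filter]
  exact hρ _ (filter_subset _ _)

end One

/-! ## §2 Along `K`: p609004's TV hypothesis and its road, pushed to any coarser key [folklore] -/
section AlongK
variable {l₀ vol : ℝ} {T : ℕ → Finset ι} {f : ℕ → ι → κ} {A B : ℕ → ℝ → ι → ℝ}

/-- **★ p609004's CLASS-LAW TV HYPOTHESIS DESCENDS TO EVERY COARSER KEY, SAME RADIUS** [folklore].  With one coarsening map per level `f K : ι → κ`,
coarse carriers `(T K).image (f K)` and fibre-summed weights `k ↦ Σ_{τ ∈ T K, f K τ = k} A K t τ` (resp. `B`): the per-set letter `hρ` at the fine key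
implies `hρ` VERBATIM at the coarse key. -/
theorem classLawTV_push_of_classLawTV {ρ : ℕ → ℝ}
    (hρ : ∀ (K : ℕ) (t : ℝ), |t| ≤ l₀ → ∀ S ⊆ T K,
      |(∑ τ ∈ S, A K t τ) / (∑ τ ∈ T K, A K t τ) - (∑ τ ∈ S, B K t τ) / (∑ τ ∈ T K, B K t τ)| ≤ ρ K) :
    ∀ (K : ℕ) (t : ℝ), |t| ≤ l₀ → ∀ S' ⊆ (T K).image (f K),
      |(∑ k ∈ S', ∑ τ ∈ (T K).filter (fun τ => f K τ = k), A K t τ)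
            / (∑ k ∈ (T K).image (f K), ∑ τ ∈ (T K).filter (fun τ => f K τ = k), A K t τ)
        - (∑ k ∈ S', ∑ τ ∈ (T K).filter (fun τ => f K τ = k), B K t τ)
            / (∑ k ∈ (T K).image (f K), ∑ τ ∈ (T K).filter (fun τ => f K τ = k), B K t τ)| ≤ ρ K :=
  fun K t ht _ hS' => abs_pushClassLaw_sub_le_of_classLaw (hρ K t ht) hS'

/-- **★★ THE CLASS-LAW ROAD AT ANY COARSER KEY** [folklore].  p609004's hypotheses AT THE FINE KEY — nonnegative term weights, positive totals, the E1∕E2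
dictionary `Z K t = Σ_T A K t`, `Z (K+1) t = Σ_T B K t`, node U5's DECL target `Target vol l₀ δ Z`, a TV radius `0 ≤ ρ_K < 1` with `Σ ρ_K < ∞` and the per-set
letter `hρ` — give the hybrid binder list AT THE COARSE KEY `f`: `∃ shA shB, HybridNE7 l₀ vol (K ↦ (T K).image (f K)) A′ B′ (fun _ _ => ∅) (fun _ => 0) shA shB ρ δ`
for the fibre-summed weights `A′ K t k = Σ_{τ ∈ T K, f K τ = k} A K t τ`, `B′` likewise — totals, dictionary and Target are unchanged (`sum_push_image_eq_sum`), the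
letter contracts (`classLawTV_push_of_classLawTV`), and `exists_hybridNE7_of_target_of_classLawTV` (p609004) applies BY NAME.  READING (iii) of p609004, kernel. -/
theorem exists_hybridNE7_push_of_target_of_classLawTV (hl₀ : 0 ≤ l₀)
    (hA : ∀ (K : ℕ) (t : ℝ), |t| ≤ l₀ → ∀ τ ∈ T K, 0 ≤ A K t τ) (hB : ∀ (K : ℕ) (t : ℝ), |t| ≤ l₀ → ∀ τ ∈ T K, 0 ≤ B K t τ)
    (hZA : ∀ (K : ℕ) (t : ℝ), |t| ≤ l₀ → 0 < ∑ τ ∈ T K, A K t τ) (hZB : ∀ (K : ℕ) (t : ℝ), |t| ≤ l₀ → 0 < ∑ τ ∈ T K, B K t τ)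
    {Z : ℕ → ℝ → ℝ} (hZA' : ∀ (K : ℕ) (t : ℝ), |t| ≤ l₀ → Z K t = ∑ τ ∈ T K, A K t τ)
    (hZB' : ∀ (K : ℕ) (t : ℝ), |t| ≤ l₀ → Z (K + 1) t = ∑ τ ∈ T K, B K t τ) {δ : ℕ → ℝ} (hT : Target vol l₀ δ Z)
    {ρ : ℕ → ℝ} (hρ0 : ∀ K, 0 ≤ ρ K) (hρ1 : ∀ K, ρ K < 1) (hρs : Summable ρ)
    (hρ : ∀ (K : ℕ) (t : ℝ), |t| ≤ l₀ → ∀ S ⊆ T K,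
      |(∑ τ ∈ S, A K t τ) / (∑ τ ∈ T K, A K t τ) - (∑ τ ∈ S, B K t τ) / (∑ τ ∈ T K, B K t τ)| ≤ ρ K)
    (f : ℕ → ι → κ) :
    ∃ shA shB : ℕ → ℝ → κ → ℝ,
      HybridNE7 l₀ vol (fun K => (T K).image (f K))
        (fun K t k => ∑ τ ∈ (T K).filter (fun τ => f K τ = k), A K t τ)
        (fun K t k => ∑ τ ∈ (T K).filter (fun τ => f K τ = k), B K t τ)
        (fun _ _ => ∅) (fun _ => 0) shA shB ρ δ := by
  refine exists_hybridNE7_of_target_of_classLawTV hl₀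
    (fun K t ht k _ => sum_nonneg fun τ hτ => hA K t ht τ (mem_filter.1 hτ).1)
    (fun K t ht k _ => sum_nonneg fun τ hτ => hB K t ht τ (mem_filter.1 hτ).1)
    (fun K t ht => ?_) (fun K t ht => ?_) (fun K t ht => ?_) (fun K t ht => ?_) hT hρ0 hρ1 hρs
    (classLawTV_push_of_classLawTV hρ)
  · rw [sum_push_image_eq_sum]; exact hZA K t ht
  · rw [sum_push_image_eq_sum]; exact hZB K t ht
  · rw [sum_push_image_eq_sum]; exact hZA' K t ht
  · rw [sum_push_image_eq_sum]; exact hZB' K t ht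

end AlongK

end Summit.QuantumFields.YangMills.BalabanUVNodes.N20ClassLawTVCoarsening

end
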